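import Summits.CriticalPhenomena.PercolationContinuityZ3.Theorems.PercNearOneGluingNoHeavyQuantFarSunHairCount
import Mathlib.Analysis.SpecialFunctions.Exp
import Mathlib.Algebra.Order.BigOperators.Ring.Finset
import HarnessLib

/-!
# FAR beyond trees: exponential-moment (Chernoff) bounds, means and joint laws of hair counts at the `hairW` level

builds on p205010 (kernel theorem, internal audit signed; external expert review pending)

Support file (`--supports stmt-CriticalPhenomena-4575`), seat `prim-cert-1` (gen 37); memo `prim-cert-1/FROM-prim-cert-1-g37-SURPLUS-FAR.md` §7.
Tools for the large-`Σ` analysis of the averaged witness weight (LEMMA 1 of the memo: `Σ_k h_k ≥ 14 ⇒ G_avg ≥ 1`), all by the one-hair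
induction of `…QuantFarSunHairCount` (`HairyCycle.sum_hairW_count_succ`, `HairyCycle.sum_hairW_count_mul_count`):

* `HairyCycle.sum_hairW_pow_count` — the exponential moment of the open count in an index set `C`:
  `Σ_Q hairW K h Q · θ^{#(Q ∩ C)} = Π_{k<K, k∈C} (1 − h k + θ·h k)`.
* `HairyCycle.pow_mul_sum_hairW_count_le_exp` — **Chernoff**: for `0 < θ ≤ 1` and `h ∈ [0,1]` on `range K`,
  `θ^c · P(#(Q ∩ C) ≤ c) ≤ exp(−(1−θ)·E(C))`, `E(C) = Σ_{k<K, k∈C} h k`.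
* `HairyCycle.sum_hairW_count_eq_mean` — `Σ_Q hairW K h Q · #(Q ∩ C) = E(C)`.
* `HairyCycle.sum_hairW_fun_two_counts` — the JOINT law of the counts in disjoint `C`, `D` is the product of the marginals:
  `Σ_Q hairW·F(#(Q∩C), #(Q∩D)) = Σ_{a,b ≤ K} M_C(a) M_D(b) F(a,b)` with `M_C(a) = Σ_Q hairW·𝟙[#(Q∩C) = a]`.
* `HairyCycle.flank_sum_lower_bound` — a Cauchy–Schwarz (Sedrakyan) lower bound for the "flank efficiency":
  for nonnegative weights `p a`, `q b` (`a, b ≤ n`), `Σ_{a,b ≥ 2} p a q b/(a+b+1) ≥ (πφ)²/(φ·m_p + π·m_q + πφ)` where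
  `π = Σ_{a≥2} p a`, `φ = Σ_{b≥2} q b`, `m_p = Σ_{a≥2} a·p a`, `m_q = Σ_{b≥2} b·q b`.
No definitions, no sorries, standard axioms.  Elementary [this work].
-/

noncomputable section

namespace Summit.CriticalPhenomena.PercolationContinuityZ3.Theorems.HairyCycle

open Finset
open scoped Classical

variable {K : ℕ}

/-! ## Exponential moment and Chernoff bound -/

/-- **Exponential moment of the open count in `C`**: `Σ_Q hairW K h Q · θ^{#(Q ∩ C)} = Π_{k ∈ range K, k ∈ C} (1 − h k + θ·h k)`. [this work] -/
theorem sum_hairW_pow_count (h : ℕ → ℝ) (C : Finset ℕ) (θ : ℝ) : ∀ K : ℕ,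
    ∑ Q ∈ (range K).powerset, hairW K h Q * θ ^ (Q ∩ C).card = ∏ k ∈ (range K).filter (fun k => k ∈ C), (1 - h k + θ * h k) := by
  intro K
  induction K with
  | zero => simp [hairW]
  | succ K ih =>
    rw [sum_hairW_count_succ K h C (fun n => θ ^ n), Finset.range_add_one, Finset.filter_insert]
    by_cases hKC : K ∈ C
    · rw [if_pos hKC, if_pos hKC, Finset.prod_insert (by simp), ih]
      have : ∑ Q ∈ (range K).powerset, hairW K h Q * θ ^ ((Q ∩ C).card + 1) =
          θ * ∑ Q ∈ (range K).powerset, hairW K h Q * θ ^ (Q ∩ C).card := by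
        rw [Finset.mul_sum]
        exact Finset.sum_congr rfl fun Q _ => by rw [pow_succ]; ring
      rw [this, ih]
      ring
    · rw [if_neg hKC, if_neg hKC, ih]

/-- **Chernoff bound for a lower tail of the open count in `C`**: for `0 < θ ≤ 1` and `h ∈ [0,1]` on `range K`,
`θ^c · Σ_Q hairW K h Q·𝟙[#(Q ∩ C) ≤ c] ≤ exp(−(1−θ)·Σ_{k ∈ range K, k ∈ C} h k)`. [this work] -/
theorem pow_mul_sum_hairW_count_le_exp {h : ℕ → ℝ} (hh : ∀ k, k < K → 0 ≤ h k ∧ h k ≤ 1) (C : Finset ℕ) (c : ℕ)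
    {θ : ℝ} (hθ0 : 0 < θ) (hθ1 : θ ≤ 1) :
    θ ^ c * ∑ Q ∈ (range K).powerset, hairW K h Q * (if (Q ∩ C).card ≤ c then (1 : ℝ) else 0) ≤
      Real.exp (-(1 - θ) * ∑ k ∈ (range K).filter (fun k => k ∈ C), h k) := by
  -- `θ^c 𝟙[n ≤ c] ≤ θ^n`
  have h1 : θ ^ c * ∑ Q ∈ (range K).powerset, hairW K h Q * (if (Q ∩ C).card ≤ c then (1 : ℝ) else 0) ≤
      ∑ Q ∈ (range K).powerset, hairW K h Q * θ ^ (Q ∩ C).card := by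
    rw [Finset.mul_sum]
    refine Finset.sum_le_sum fun Q _ => ?_
    have hw := hairW_nonneg hh Q
    split_ifs with hc
    · rw [mul_one, mul_comm]
      exact mul_le_mul_of_nonneg_left (pow_le_pow_of_le_one hθ0.le hθ1 hc) hw
    · rw [mul_zero, mul_zero]; exact mul_nonneg hw (pow_nonneg hθ0.le _)
  refine h1.trans ?_
  rw [sum_hairW_pow_count h C θ K]
  -- each factor `1 − (1−θ) h k ≤ exp(−(1−θ) h k)`
  have h2 : ∏ k ∈ (range K).filter (fun k => k ∈ C), (1 - h k + θ * h k) ≤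
      ∏ k ∈ (range K).filter (fun k => k ∈ C), Real.exp (-(1 - θ) * h k) := by
    refine Finset.prod_le_prod (fun k hk => ?_) (fun k hk => ?_)
    · have hkK := (hh k (Finset.mem_range.1 (Finset.mem_filter.1 hk).1))
      nlinarith [hkK.1, hkK.2]
    · have := Real.add_one_le_exp (-(1 - θ) * h k)
      linarith
  refine h2.trans (le_of_eq ?_)
  rw [← Real.exp_sum, Finset.mul_sum]

/-! ## Mean -/

/-- **Mean of the open count in `C`**: `Σ_Q hairW K h Q · #(Q ∩ C) = Σ_{k ∈ range K, k ∈ C} h k`. [this work] -/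
theorem sum_hairW_count_eq_mean (h : ℕ → ℝ) (C : Finset ℕ) : ∀ K : ℕ,
    ∑ Q ∈ (range K).powerset, hairW K h Q * ((Q ∩ C).card : ℝ) = ∑ k ∈ (range K).filter (fun k => k ∈ C), h k := by
  intro K
  induction K with
  | zero => simp [hairW]
  | succ K ih =>
    rw [sum_hairW_count_succ K h C (fun n => (n : ℝ)), Finset.range_add_one, Finset.filter_insert]
    by_cases hKC : K ∈ C
    · rw [if_pos hKC, if_pos hKC, Finset.sum_insert (by simp), ih]
      have e : ∑ Q ∈ (range K).powerset, hairW K h Q * (((Q ∩ C).card + 1 : ℕ) : ℝ) =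
          ∑ Q ∈ (range K).powerset, hairW K h Q * ((Q ∩ C).card : ℝ) + ∑ Q ∈ (range K).powerset, hairW K h Q := by
        rw [← Finset.sum_add_distrib]
        exact Finset.sum_congr rfl fun Q _ => by push_cast; ring
      rw [e, ih, sum_hairW_eq_one]
      ring
    · rw [if_neg hKC, if_neg hKC, ih]

/-! ## Joint law of two counts -/

/-- **Joint law = product of marginals** for the open counts in disjoint `C`, `D`: for every `F`,
`Σ_Q hairW K h Q · F(#(Q∩C), #(Q∩D)) = Σ_{a ≤ K} Σ_{b ≤ K} M_C(a) · M_D(b) · F(a,b)`, `M_C(a) = Σ_Q hairW K h Q·𝟙[#(Q∩C) = a]`. [this work] -/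
theorem sum_hairW_fun_two_counts (h : ℕ → ℝ) {C D : Finset ℕ} (hCD : Disjoint C D) (F : ℕ → ℕ → ℝ) :
    ∑ Q ∈ (range K).powerset, hairW K h Q * F (Q ∩ C).card (Q ∩ D).card =
      ∑ a ∈ range (K + 1), ∑ b ∈ range (K + 1),
        (∑ Q ∈ (range K).powerset, hairW K h Q * (if (Q ∩ C).card = a then (1 : ℝ) else 0)) *
        (∑ Q ∈ (range K).powerset, hairW K h Q * (if (Q ∩ D).card = b then (1 : ℝ) else 0)) * F a b := by
  -- `F(m, n) = Σ_{a,b} 𝟙[m = a] 𝟙[n = b] F(a,b)` for `m, n ≤ K`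
  have hF : ∀ Q ∈ (range K).powerset, hairW K h Q * F (Q ∩ C).card (Q ∩ D).card =
      ∑ a ∈ range (K + 1), ∑ b ∈ range (K + 1),
        hairW K h Q * ((if (Q ∩ C).card = a then (1 : ℝ) else 0) * (if (Q ∩ D).card = b then (1 : ℝ) else 0)) * F a b := by
    intro Q hQ
    rw [Finset.mem_powerset] at hQ
    have hCa : (Q ∩ C).card ∈ range (K + 1) := by
      rw [Finset.mem_range]
      have := (Finset.card_le_card (Finset.inter_subset_left (s₁ := Q) (s₂ := C))).trans ((Finset.card_le_card hQ).trans (Finset.card_range K).le)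
      omega
    have hDb : (Q ∩ D).card ∈ range (K + 1) := by
      rw [Finset.mem_range]
      have := (Finset.card_le_card (Finset.inter_subset_left (s₁ := Q) (s₂ := D))).trans ((Finset.card_le_card hQ).trans (Finset.card_range K).le)
      omega
    rw [Finset.sum_eq_single_of_mem _ hCa (fun a _ ha => Finset.sum_eq_zero fun b _ => by
      rw [if_neg (Ne.symm ha)]; ring)]
    rw [Finset.sum_eq_single_of_mem _ hDb (fun b _ hb => by rw [if_neg (Ne.symm hb)]; ring)]
    simp
  rw [Finset.sum_congr rfl hF, Finset.sum_comm]
  refine Finset.sum_congr rfl fun a _ => ?_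
  rw [Finset.sum_comm]
  refine Finset.sum_congr rfl fun b _ => ?_
  rw [← Finset.sum_mul, sum_hairW_count_mul_count h hCD K (fun n => if n = a then (1 : ℝ) else 0) (fun n => if n = b then (1 : ℝ) else 0)]

/-! ## A Cauchy–Schwarz lower bound for the flank efficiency -/

/-- **Flank-efficiency lower bound.**  For nonnegative `p a`, `q b` (`a, b ∈ range (n+1)`):
`Σ_a Σ_b 𝟙[2 ≤ a] 𝟙[2 ≤ b] p a q b/(a+b+1) · (φ·m_p + π·m_q + π·φ) ≥ (π·φ)²`, where `π = Σ_{a ≥ 2} p a`, `φ = Σ_{b≥2} q b`,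
`m_p = Σ_{a≥2} a·p a`, `m_q = Σ_{b ≥ 2} b·q b` (Sedrakyan's form of Cauchy–Schwarz with weights `p a q b` and values `a+b+1`). [this work] -/
theorem flank_sum_lower_bound (n : ℕ) (p q : ℕ → ℝ) (hp : ∀ a, 0 ≤ p a) (hq : ∀ b, 0 ≤ q b) :
    (∑ a ∈ (range (n + 1)).filter (fun a => 2 ≤ a), p a) ^ 2 * (∑ b ∈ (range (n + 1)).filter (fun b => 2 ≤ b), q b) ^ 2 ≤
      (∑ a ∈ (range (n + 1)).filter (fun a => 2 ≤ a), ∑ b ∈ (range (n + 1)).filter (fun b => 2 ≤ b), p a * q b / ((a : ℝ) + b + 1)) *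
      ((∑ b ∈ (range (n + 1)).filter (fun b => 2 ≤ b), q b) * (∑ a ∈ (range (n + 1)).filter (fun a => 2 ≤ a), (a : ℝ) * p a) +
       (∑ a ∈ (range (n + 1)).filter (fun a => 2 ≤ a), p a) * (∑ b ∈ (range (n + 1)).filter (fun b => 2 ≤ b), (b : ℝ) * q b) +
       (∑ a ∈ (range (n + 1)).filter (fun a => 2 ≤ a), p a) * (∑ b ∈ (range (n + 1)).filter (fun b => 2 ≤ b), q b)) := by
  set A := (range (n + 1)).filter (fun a => 2 ≤ a) with hA
  -- Cauchy–Schwarz on the index set `A × A` with `r = p a q b`, `f = p a q b/(a+b+1)`, `g = p a q b (a+b+1)`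
  have hcs := Finset.sum_sq_le_sum_mul_sum_of_sq_le_mul (A ×ˢ A)
    (f := fun x => p x.1 * q x.2 / ((x.1 : ℝ) + x.2 + 1)) (g := fun x => p x.1 * q x.2 * ((x.1 : ℝ) + x.2 + 1))
    (r := fun x => p x.1 * q x.2)
    (fun x _ => div_nonneg (mul_nonneg (hp _) (hq _)) (by positivity))
    (fun x _ => mul_nonneg (mul_nonneg (hp _) (hq _)) (by positivity))
    (fun x _ => by
      have hpos : (0 : ℝ) < (x.1 : ℝ) + x.2 + 1 := by positivity
      rw [div_mul_eq_mul_div, le_div_iff₀ hpos]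
      nlinarith)
  -- identify the three sums
  have e1 : ∑ x ∈ A ×ˢ A, p x.1 * q x.2 = (∑ a ∈ A, p a) * (∑ b ∈ A, q b) := by
    rw [Finset.sum_product, Finset.sum_mul_sum]
  have e2 : ∑ x ∈ A ×ˢ A, p x.1 * q x.2 / ((x.1 : ℝ) + x.2 + 1) = ∑ a ∈ A, ∑ b ∈ A, p a * q b / ((a : ℝ) + b + 1) := by
    rw [Finset.sum_product]
  have e3 : ∑ x ∈ A ×ˢ A, p x.1 * q x.2 * ((x.1 : ℝ) + x.2 + 1) =
      (∑ b ∈ A, q b) * (∑ a ∈ A, (a : ℝ) * p a) + (∑ a ∈ A, p a) * (∑ b ∈ A, (b : ℝ) * q b) + (∑ a ∈ A, p a) * (∑ b ∈ A, q b) := by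
    rw [Finset.sum_product]
    have : ∀ a ∈ A, ∑ b ∈ A, p a * q b * ((a : ℝ) + b + 1) =
        (∑ b ∈ A, q b) * ((a : ℝ) * p a) + p a * (∑ b ∈ A, (b : ℝ) * q b) + p a * (∑ b ∈ A, q b) := by
      intro a _
      rw [Finset.sum_mul, Finset.mul_sum, Finset.mul_sum, ← Finset.sum_add_distrib, ← Finset.sum_add_distrib]
      exact Finset.sum_congr rfl fun b _ => by ring
    rw [Finset.sum_congr rfl this, Finset.sum_add_distrib, Finset.sum_add_distrib, ← Finset.mul_sum, ← Finset.sum_mul,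
      ← Finset.sum_mul]
  rw [e1, e2, e3] at hcs
  have e4 : ((∑ a ∈ A, p a) * ∑ b ∈ A, q b) ^ 2 = (∑ a ∈ A, p a) ^ 2 * (∑ b ∈ A, q b) ^ 2 := by ring
  rw [e4] at hcs
  exact hcs

end Summit.CriticalPhenomena.PercolationContinuityZ3.Theorems.HairyCycle

end
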